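import Summits.BirchSwinnertonDyer.BirchSwinnertonDyer.Theorems.SylvesterTwoHeegnerIndexCoupledTelescopeLiftInterleave
import Summits.BirchSwinnertonDyer.BirchSwinnertonDyer.Theorems.SylvesterTwoHeegnerIndexCoupledTelescopeLiftIsotropy
import HarnessLib

/-!
# The COUPLED Cassels–Tate telescope, XVII-a: the TAIL BLOCK — hT^κ's lift/isotropy/independence/
# (coiso)/(gen) conjuncts (display (iii) p704180 l.206–236) as ONE nested conjunction from two lift
# families (generic-witness; #K10b `interleaved_lift_clauses` + #K12 `isotropy_of_images`)

Crux `UpperOffV0HSYPlus` (stmt-BirchSwinnertonDyer-19804).  Pure bookkeeping for the assembly file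
`…CoupledTelescopeTailFourOfResidue` / `…TailSevenOfResidue`: the final `∃`-block of hT^κ ends with the
thirteen conjuncts l.206–236 (annihilation by parity, exact orders on `Finset.Ioc 0 K₀`, room, the two
ISOTROPY clauses for the displayed Selmer pairings `PA`/`PB`, `𝒪`-independence (with the bottom class
`x` on `B`), and per curve (coiso) + (gen)); `exists_tailBlock` produces `K₀, sA, sB, N, hselA, hselB`,
the two admissibility clauses (l.138) and that thirteen-clause conjunction VERBATIM-SHAPED in generic
types, from the two per-curve lift families (outputs of `exists_lift_family_tree`, p708738), the
isotropy data of #K12 (`ι₂`, `hι₂`, isotropic `D_X = closure (T_X ∪ w '' T_X)`, the pull-back equation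
of `P_X`) and the two (coiso) clauses passed through.  Theorem-only (no definition, no named fact);
nothing asserted on 19804; no stub closed; BSD not claimed for any curve.  Sources: McCallum 1991 §5
Thm. 5.4 (proof, p. 288); MEMO-bsd-cm-two §59.2, §64.5.
-/

-- every Summits module is named `Summit.<Summit>.<Problem>…`: the duplicated component is by design
set_option linter.dupNamespace false
set_option autoImplicit false

open scoped Classical

namespace Summit.BirchSwinnertonDyer.BirchSwinnertonDyer.Theorems.SylvesterTwoCoupledTelescope

section TailBlock

variable {SA SB MA MB QA QB R : Type*} [AddCommGroup SA] [AddCommGroup SB] [AddCommGroup MA]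
  [AddCommGroup MB] [AddCommGroup QA] [AddCommGroup QB] [AddCommGroup R]

/-- **The TAIL BLOCK** (module docstring): `K₀, sA, sB, N, hselA, hselB`, admissibility, and hT^κ's
conjuncts l.206–236 as one nested conjunction, from two lift families + #K12's isotropy data + the two
(coiso) clauses. [cite: McCallumLMS1991, §5 Thm. 5.4 (proof, p. 288)] -/
theorem exists_tailBlock (SelA : AddSubgroup SA) (SelB : AddSubgroup SB) (AdmA : Set SA)
    (AdmB : Set SB) (wA : SA →+ SA) (wB : SB →+ SB)
    (hwSelA : ∀ s ∈ SelA, wA s ∈ SelA) (hwSelB : ∀ s ∈ SelB, wB s ∈ SelB)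
    (τA : SA →+ QA) (τB : SB →+ QB) (ιA : MA →+ QA) (ιB : MB →+ QB)
    (hιA : Function.Injective ιA) (hιB : Function.Injective ιB)
    (wMA : MA →+ MA) (wMB : MB →+ MB)
    (hwA' : ∀ a, wMA (wMA a) = -a - wMA a) (hwB' : ∀ b, wMB (wMB b) = -b - wMB b)
    (TA : Set MA) (TB : Set MB) (x : SB) (κ : ℕ)
    -- the isotropy data (#K12): `ι₂`, the isotropic `D_X`, the pull-back equation of `P_X`
    (ι₂A : SelA →+ MA) (hι₂A : ∀ z : SelA, ιA (ι₂A z) = τA z)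
    (ι₂B : SelB →+ MB) (hι₂B : ∀ z : SelB, ιB (ι₂B z) = τB z)
    (BA : MA →+ MA →+ R) (BB : MB →+ MB →+ R)
    (hisoA : ∀ a ∈ AddSubgroup.closure (TA ∪ wMA '' TA), ∀ b ∈ AddSubgroup.closure (TA ∪ wMA '' TA),
      BA a b = 0)
    (hisoB : ∀ a ∈ AddSubgroup.closure (TB ∪ wMB '' TB), ∀ b ∈ AddSubgroup.closure (TB ∪ wMB '' TB),
      BB a b = 0)
    (PA : SelA →+ SelA →+ R × R) (PB : SelB →+ SelB →+ R × R)
    (hPA : ∀ z t, PA z t = (BA (ι₂A z) (ι₂A t), BA (ι₂A z) (wMA (ι₂A t))))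
    (hPB : ∀ z t, PB z t = (BB (ι₂B z) (ι₂B t), BB (ι₂B z) (wMB (ι₂B t))))
    -- the two (coiso) clauses, passed through
    (hcoA : ∀ t, (∀ d ∈ AddSubgroup.closure (TA ∪ wMA '' TA), BA t d = 0) →
      t ∈ AddSubgroup.closure (TA ∪ wMA '' TA))
    (hcoB : ∀ t, (∀ d ∈ AddSubgroup.closure (TB ∪ wMB '' TB), BB t d = 0) →
      t ∈ AddSubgroup.closure (TB ∪ wMB '' TB))
    -- the `A`-family (no bottom class)
    (mA : ℕ) (sA₁ : ℕ → SA) (NA₁ : ℕ → ℕ) (hSelA₁ : ∀ i, sA₁ i ∈ SelA) (hAdmA₁ : ∀ i, sA₁ i ∈ AdmA)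
    (hzeroA : ∀ i, mA ≤ i → sA₁ i = 0 ∧ NA₁ i = 0) (hNA₁ : ∀ i, ((2 : ℤ) ^ NA₁ i) • sA₁ i = 0)
    (hexA : ∀ i < mA, NA₁ i ≠ 0 → ((2 : ℤ) ^ (NA₁ i - 1)) • sA₁ i ≠ 0) (hleA : ∀ i, NA₁ i ≤ κ)
    (himgA : ∀ i, ∃ a ∈ AddSubgroup.closure (TA ∪ wMA '' TA),
      τA (sA₁ i) = ιA a ∧ τA (wA (sA₁ i)) = ιA (wMA a))
    (hindA₁ : ∀ (I : Finset ℕ) (α β : ℕ → ℤ), ∑ i ∈ I, (α i • sA₁ i + β i • wA (sA₁ i)) = 0 →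
      ∀ i ∈ I, α i • sA₁ i + β i • wA (sA₁ i) = 0)
    (hgenA₁ : ∀ d ∈ AddSubgroup.closure (TA ∪ wMA '' TA), ∃ g ∈ AddSubgroup.closure
      ((((Finset.range mA).image sA₁ : Finset SA) : Set SA) ∪
        wA '' (((Finset.range mA).image sA₁ : Finset SA) : Set SA)), τA g = ιA d)
    -- the `B`-family (with the bottom class `x`)
    (mB : ℕ) (sB₁ : ℕ → SB) (NB₁ : ℕ → ℕ) (hSelB₁ : ∀ i, sB₁ i ∈ SelB) (hAdmB₁ : ∀ i, sB₁ i ∈ AdmB)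
    (hzeroB : ∀ i, mB ≤ i → sB₁ i = 0 ∧ NB₁ i = 0) (hNB₁ : ∀ i, ((2 : ℤ) ^ NB₁ i) • sB₁ i = 0)
    (hexB : ∀ i < mB, NB₁ i ≠ 0 → ((2 : ℤ) ^ (NB₁ i - 1)) • sB₁ i ≠ 0) (hleB : ∀ i, NB₁ i ≤ κ)
    (himgB : ∀ i, ∃ b ∈ AddSubgroup.closure (TB ∪ wMB '' TB),
      τB (sB₁ i) = ιB b ∧ τB (wB (sB₁ i)) = ιB (wMB b))
    (hindB₁ : ∀ (I : Finset ℕ) (b c : ℤ) (α β : ℕ → ℤ),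
      (b • x + c • wB x) + ∑ i ∈ I, (α i • sB₁ i + β i • wB (sB₁ i)) = 0 →
        b • x + c • wB x = 0 ∧ ∀ i ∈ I, α i • sB₁ i + β i • wB (sB₁ i) = 0)
    (hgenB₁ : ∀ d ∈ AddSubgroup.closure (TB ∪ wMB '' TB), ∃ g ∈ AddSubgroup.closure
      ((((Finset.range mB).image sB₁ : Finset SB) : Set SB) ∪
        wB '' (((Finset.range mB).image sB₁ : Finset SB) : Set SB)), τB g = ιB d) :
    ∃ (K₀ : ℕ) (sA : ℕ → SA) (sB : ℕ → SB) (N : ℕ → ℕ)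
      (hselA : ∀ i, sA i ∈ SelA) (hselB : ∀ i, sB i ∈ SelB),
      (∀ i, sA i ∈ AdmA) ∧ (∀ i, sB i ∈ AdmB) ∧
      ((∀ i, Odd i → ((2 : ℤ) ^ N i) • sA i = 0) ∧ (∀ i, Even i → ((2 : ℤ) ^ N i) • sB i = 0) ∧
      (∀ i ∈ Finset.Ioc 0 K₀, Odd i → N i ≠ 0 → ((2 : ℤ) ^ (N i - 1)) • sA i ≠ 0) ∧
      (∀ i ∈ Finset.Ioc 0 K₀, Even i → N i ≠ 0 → ((2 : ℤ) ^ (N i - 1)) • sB i ≠ 0) ∧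
      (∀ i ∈ Finset.Ioc 0 K₀, N i ≤ κ) ∧
      (∀ i i', Odd i → Odd i' → PA ⟨sA i, hselA i⟩ ⟨sA i', hselA i'⟩ = 0 ∧
        PA ⟨wA (sA i), hwSelA _ (hselA i)⟩ ⟨sA i', hselA i'⟩ = 0) ∧
      (∀ i i', Even i → Even i' → PB ⟨sB i, hselB i⟩ ⟨sB i', hselB i'⟩ = 0 ∧
        PB ⟨wB (sB i), hwSelB _ (hselB i)⟩ ⟨sB i', hselB i'⟩ = 0) ∧
      (∀ (α β : ℕ → ℤ),
        ∑ j ∈ (Finset.Ioc 0 K₀).filter (fun j ↦ Odd j), (α j • sA j + β j • wA (sA j)) = 0 →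
          ∀ j ∈ (Finset.Ioc 0 K₀).filter (fun j ↦ Odd j), α j • sA j + β j • wA (sA j) = 0) ∧
      (∀ (b c : ℤ) (α β : ℕ → ℤ),
        (b • x + c • wB x) +
            ∑ j ∈ (Finset.Ioc 0 K₀).filter (fun j ↦ Even j), (α j • sB j + β j • wB (sB j)) = 0 →
          b • x + c • wB x = 0 ∧
            ∀ j ∈ (Finset.Ioc 0 K₀).filter (fun j ↦ Even j), α j • sB j + β j • wB (sB j) = 0) ∧
      (∀ t, (∀ d ∈ AddSubgroup.closure (TA ∪ wMA '' TA), BA t d = 0) →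
        t ∈ AddSubgroup.closure (TA ∪ wMA '' TA)) ∧
      (∀ d ∈ AddSubgroup.closure (TA ∪ wMA '' TA), ∃ g ∈ AddSubgroup.closure
          (((((Finset.Ioc 0 K₀).filter (fun j ↦ Odd j)).image sA : Finset SA) : Set SA) ∪
            wA '' ((((Finset.Ioc 0 K₀).filter (fun j ↦ Odd j)).image sA : Finset SA) : Set SA)),
        τA g = ιA d) ∧
      (∀ t, (∀ d ∈ AddSubgroup.closure (TB ∪ wMB '' TB), BB t d = 0) →
        t ∈ AddSubgroup.closure (TB ∪ wMB '' TB)) ∧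
      (∀ d ∈ AddSubgroup.closure (TB ∪ wMB '' TB), ∃ g ∈ AddSubgroup.closure
          (((((Finset.Ioc 0 K₀).filter (fun j ↦ Even j)).image sB : Finset SB) : Set SB) ∪
            wB '' ((((Finset.Ioc 0 K₀).filter (fun j ↦ Even j)).image sB : Finset SB) : Set SB)),
        τB g = ιB d)) := by
  obtain ⟨K₀, sA, sB, N, hselA, hselB, sA_adm, sB_adm, hNA, hNB, hNA', hNB', hroom, himgA', himgB',
    hindA, hindB, hgenA, hgenB⟩ :=
    interleaved_lift_clauses SelA SelB AdmA AdmB wA wB τA τB ιA ιB wMA wMB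
      (AddSubgroup.closure (TA ∪ wMA '' TA)) (AddSubgroup.closure (TB ∪ wMB '' TB)) x κ mA sA₁ NA₁
      hSelA₁ hAdmA₁ hzeroA hNA₁ hexA hleA himgA hindA₁ hgenA₁ mB sB₁ NB₁ hSelB₁ hAdmB₁ hzeroB hNB₁
      hexB hleB himgB hindB₁ hgenB₁
  have hisoA' := isotropy_of_images SelA wA hwSelA τA ιA hιA ι₂A hι₂A wMA hwA' TA BA hisoA PA hPA sA
    hselA himgA'
  have hisoB' := isotropy_of_images SelB wB hwSelB τB ιB hιB ι₂B hι₂B wMB hwB' TB BB hisoB PB hPB sB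
    hselB himgB'
  exact ⟨K₀, sA, sB, N, hselA, hselB, sA_adm, sB_adm, hNA, hNB, hNA', hNB', hroom,
    fun i i' _ _ ↦ hisoA' i i', fun i i' _ _ ↦ hisoB' i i', hindA, hindB, hcoA, hgenA, hcoB, hgenB⟩

end TailBlock

end Summit.BirchSwinnertonDyer.BirchSwinnertonDyer.Theorems.SylvesterTwoCoupledTelescope
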